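import Summits.CriticalPhenomena.PercolationContinuityZ3.Theorems.Transplant.SkelPhiNegReachReadBK
import HarnessLib

/-!
# N1 (the `{±1}` node), (C) column under (ζ′) — file (C-S9b-K): THE ROOMS OF THE LOCALISATION ROUNDS WITH THE BOX MULTIPLIER `kq`
# (the twin of `SkelPhiNegReachRoomsAB` (C-S9b, p300624) at `40·kq` strides per `r`): the hypotheses `hrdA / hrdA'` (signed v-rounds
# `vLocPrmD n ℓ h v T W_A L0_A N_A`, axis `1`) and `hrd₂ / hrd₂'` (u-rounds `xLocPrm n ℓ h T W_B L0_B N_B`, axis `0`) of `reachOblRHN_negSG₂b(_of_inputs)`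
# at the record values `CorrRec.*`: every region of either segment reads inside `±(2r_i − 1)` on both axes, by `rooms_smallK` (C-S9a-K) from the two
# SMALL-BOX FLOORS of each segment in the (ζ′) scale: `U·(X₁ + 1) ≤ 77kq·Δ` and `Δ·X₀ + |v|·U·(X₁ + 1) ≤ 76kq·Δ·n`, where `X₀ := L0_B + T + n` (both
# segments), `X₁ := L0_A + W_B + T + La_A` (segment A), `X₁ := q_y + Lb_B` (segment B), `La_A = Lb_B = ⌊3nℓ/U⌋ + 1`; commensurability
# `c_i'·A·(40kq·Δ) = r_i·D`, `40kq ≤ r_i`. The case `kq = 1` is the record (C-S9b).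

builds on p205010 (kernel theorem, internal audit signed; external expert review pending) — nothing in this file uses p205010; nothing here is a
claim about the open node `SamePDropOfSkeletonNeg₁`.
Lane `prim-bschramm`, seat `prim-bschramm-p5` (gen 11; (C) lineage); helper file (`--supports stmt-CriticalPhenomena-4575`).
[cite: KozmaNitzan2024, §4 Lemma 12 (pp. 23–25), p. 26 (Q_v, H_{v,x})] [cite: MartineauTassion2017, §4.3 Lemma 4.2]
-/

noncomputable section

namespace Summit.CriticalPhenomena.PercolationContinuityZ3.Theorems

namespace Transplant

namespace Skelφ

open Literature.Probability.Percolation Literature.Probability.LatticeModels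
open Literature.Probability.Percolation.KozmaNitzan.Cells (oth oth_ne sgOf sgOf_sign eq_oth_of_ne)
open TwoAxis.Para (modulus)
open ChainPlanar ChainPara

namespace CorrRec

section Rounds

variable {A : ℤ} {n : ℕ} {h v vβ c₀' c₁' D : ℤ} {P : PCells2} {ℓ T : ℕ} {aW bL : ℤ}
  {kq : ℕ} (hn : 1 ≤ n) (hA : 0 < A) (hD : 0 < D) (hm : 0 < modulus n h v vβ) (hc₀ : 0 < c₀') (hkq : 1 ≤ kq)
  (hsc0 : c₀' * A * (40 * (kq : ℤ) * modulus n h v vβ) = (P.r 0 : ℤ) * D) (hsc1 : c₁' * A * (40 * (kq : ℤ) * modulus n h v vβ) = (P.r 1 : ℤ) * D)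
  (hr40 : ∀ i, 40 * (kq : ℤ) ≤ (P.r i : ℤ))
include hn hA hD hm hc₀ hkq hsc0 hsc1 hr40

/-! ## §2 Segment A: the signed v-rounds -/

/-- **Every region of the v-rounds reads inside `±(2r_i − 1)` on both axes** under the two small-box floors of segment A.
[cite: KozmaNitzan2024, §4 Lemma 12 (pp. 23–25)] -/
theorem symAK (hPA : LocOKD (vLocPrmD n ℓ h v T (WA n aW) (L0A bL) (NA n ℓ h T bL)))
    (hS1 : (shearUnit n h : ℤ) * (((L0A bL : ℕ) : ℤ) + (Qw n ℓ h : ℕ) + T + (3 * (n * ℓ) / shearUnit n h + 1 : ℕ) + 1) ≤ 77 * (kq : ℤ) * modulus n h v vβ)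
    (hS0 : modulus n h v vβ * (((L0B n ℓ h v T aW bL : ℕ) : ℤ) + T + n) +
      |v| * ((shearUnit n h : ℤ) * (((L0A bL : ℕ) : ℤ) + (Qw n ℓ h : ℕ) + T + (3 * (n * ℓ) / shearUnit n h + 1 : ℕ) + 1)) ≤ 76 * (kq : ℤ) * modulus n h v vβ * n)
    {k : ℕ} (hk : k ≤ NA n ℓ h T bL) (i : Fin 2) :
    let PA := vLocPrmD n ℓ h v T (WA n aW) (L0A bL) (NA n ℓ h T bL)
    let lo := dLo 1 1 0 (-(PA.toLoc.L k + PA.e + PA.La)) (PA.toLoc.L k + PA.e + PA.La) (-(PA.Wk k + PA.e + PA.Lb)) (PA.Wk k + PA.e + PA.Lb)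
    let hi := dHi 1 1 0 (-(PA.toLoc.L k + PA.e + PA.La)) (PA.toLoc.L k + PA.e + PA.La) (-(PA.Wk k + PA.e + PA.Lb)) (PA.Wk k + PA.e + PA.Lb)
    (-(2 * (P.r i : ℤ)) + 1 ≤ rdLo A n h v vβ c₀' c₁' D lo hi i) ∧ rdHi A n h v vβ c₀' c₁' D lo hi i ≤ 2 * (P.r i : ℤ) - 1 := by
  intro PA lo hi
  dsimp only [lo, hi]
  obtain ⟨e1, e0, e1', e0'⟩ := dLoHi_one_zero 1 (-(PA.toLoc.L k + PA.e + PA.La)) (PA.toLoc.L k + PA.e + PA.La) (-(PA.Wk k + PA.e + PA.Lb))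
    (PA.Wk k + PA.e + PA.Lb)
  have ho : oth (1 : Fin 2) = 0 := by decide
  rw [ho] at e0 e0'
  -- the record's fields
  have hL0 : (PA.toLoc.L0 : ℤ) = (L0A bL : ℕ) := rfl
  have hsHi : PA.toLoc.sHi = (n : ℤ) * ℓ / (shearUnit n h : ℕ) + 1 := rfl
  have he : (PA.e : ℤ) = T := rfl
  have hLa : (PA.La : ℤ) = ((3 * (n * ℓ) / shearUnit n h + 1 : ℕ) : ℤ) := rfl
  have hLb : (PA.Lb : ℤ) = n := rfl
  have hWk : PA.Wk k = (WA n aW : ℕ) + (k : ℤ) * (T + |v|) := rfl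
  have hQ : ((Qw n ℓ h : ℕ) : ℤ) = (n : ℤ) * ℓ / (shearUnit n h : ℕ) + 1 := by unfold Qw; push_cast; rfl
  -- bounds of the corners
  have hLk : PA.toLoc.L k ≤ ((L0A bL : ℕ) : ℤ) + (Qw n ℓ h : ℕ) := by
    have h1 := LocPrm.L_le_max (LocPrmD.toLoc_ok hPA) k
    rw [hL0, hsHi] at h1; rw [hQ]
    have h0 : (0 : ℤ) ≤ (n : ℤ) * ℓ / (shearUnit n h : ℕ) := Int.ediv_nonneg (by positivity) (by positivity)
    have hL0' : (0 : ℤ) ≤ ((L0A bL : ℕ) : ℤ) := by positivity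
    exact h1.trans (max_le (by linarith) (by linarith))
  have hLk0 : 0 ≤ PA.toLoc.L k := LocPrm.L_nonneg (LocPrmD.toLoc_ok hPA) k
  have hWkb : PA.Wk k + (T + |v|) ≤ ((L0B n ℓ h v T aW bL : ℕ) : ℤ) := by
    rw [hWk]; unfold L0B; push_cast
    have hk' : (k : ℤ) ≤ (NA n ℓ h T bL : ℕ) := by exact_mod_cast hk
    have hTv : (0 : ℤ) ≤ (T : ℤ) + |v| := by positivity
    nlinarith
  have hWk0 : 0 ≤ PA.Wk k := LocPrmD.Wk_nonneg PA k
  set X₁ : ℤ := ((L0A bL : ℕ) : ℤ) + (Qw n ℓ h : ℕ) + T + (3 * (n * ℓ) / shearUnit n h + 1 : ℕ) with hX₁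
  set X₀ : ℤ := ((L0B n ℓ h v T aW bL : ℕ) : ℤ) + T + n with hX₀
  have hv0 : (0 : ℤ) ≤ |v| := abs_nonneg v
  refine rooms_smallK hn hA hD hm hc₀ hkq hsc0 hsc1 hr40 (X₀ := X₀) (X₁ := X₁) ?_ ?_ ?_ ?_ hS0 hS1 i
  · rw [e0, he, hLb]; linarith
  · rw [e0', he, hLb]; linarith
  · rw [e1, he, hLa, abs_le]; constructor <;> linarith
  · rw [e1', he, hLa, abs_le]; constructor <;> linarith

/-- **The rooms of segment A with one unit of margin** (`hrdA'` of `reachOblRHN_negSG₂b_of_inputs`). [cite: KozmaNitzan2024, §4 Lemma 12] -/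
theorem hrdA1K (hPA : LocOKD (vLocPrmD n ℓ h v T (WA n aW) (L0A bL) (NA n ℓ h T bL)))
    (hS1 : (shearUnit n h : ℤ) * (((L0A bL : ℕ) : ℤ) + (Qw n ℓ h : ℕ) + T + (3 * (n * ℓ) / shearUnit n h + 1 : ℕ) + 1) ≤ 77 * (kq : ℤ) * modulus n h v vβ)
    (hS0 : modulus n h v vβ * (((L0B n ℓ h v T aW bL : ℕ) : ℤ) + T + n) +
      |v| * ((shearUnit n h : ℤ) * (((L0A bL : ℕ) : ℤ) + (Qw n ℓ h : ℕ) + T + (3 * (n * ℓ) / shearUnit n h + 1 : ℕ) + 1)) ≤ 76 * (kq : ℤ) * modulus n h v vβ * n) :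
    ∀ du : MDir, ∀ k ≤ NA n ℓ h T bL,
      let PA := vLocPrmD n ℓ h v T (WA n aW) (L0A bL) (NA n ℓ h T bL)
      let lo := dLo 1 1 0 (-(PA.toLoc.L k + PA.e + PA.La)) (PA.toLoc.L k + PA.e + PA.La) (-(PA.Wk k + PA.e + PA.Lb)) (PA.Wk k + PA.e + PA.Lb)
      let hi := dHi 1 1 0 (-(PA.toLoc.L k + PA.e + PA.La)) (PA.toLoc.L k + PA.e + PA.La) (-(PA.Wk k + PA.e + PA.Lb)) (PA.Wk k + PA.e + PA.Lb)
      (sgOf du = 1 → -(5 * (P.r du.1 : ℤ)) + 1 ≤ rdLo A n h v vβ c₀' c₁' D lo hi du.1 ∧ rdHi A n h v vβ c₀' c₁' D lo hi du.1 ≤ 22 * (P.r du.1 : ℤ) - 1) ∧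
      (sgOf du = -1 → -(5 * (P.r du.1 : ℤ)) + 1 ≤ -rdHi A n h v vβ c₀' c₁' D lo hi du.1 ∧ -rdLo A n h v vβ c₀' c₁' D lo hi du.1 ≤ 22 * (P.r du.1 : ℤ) - 1) ∧
      (-(2 * (P.r (oth du.1) : ℤ)) + 1 ≤ rdLo A n h v vβ c₀' c₁' D lo hi (oth du.1) ∧
        rdHi A n h v vβ c₀' c₁' D lo hi (oth du.1) ≤ 2 * (P.r (oth du.1) : ℤ) - 1) :=
  fun du _ hk => rooms1_of_sym (symAK hn hA hD hm hc₀ hkq hsc0 hsc1 hr40 hPA hS1 hS0 hk) du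

/-- **The rooms of segment A** (`hrdA` of `reachOblRHN_negSG₂b`). [cite: KozmaNitzan2024, §4 Lemma 12] -/
theorem hrdA0K (hPA : LocOKD (vLocPrmD n ℓ h v T (WA n aW) (L0A bL) (NA n ℓ h T bL)))
    (hS1 : (shearUnit n h : ℤ) * (((L0A bL : ℕ) : ℤ) + (Qw n ℓ h : ℕ) + T + (3 * (n * ℓ) / shearUnit n h + 1 : ℕ) + 1) ≤ 77 * (kq : ℤ) * modulus n h v vβ)
    (hS0 : modulus n h v vβ * (((L0B n ℓ h v T aW bL : ℕ) : ℤ) + T + n) +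
      |v| * ((shearUnit n h : ℤ) * (((L0A bL : ℕ) : ℤ) + (Qw n ℓ h : ℕ) + T + (3 * (n * ℓ) / shearUnit n h + 1 : ℕ) + 1)) ≤ 76 * (kq : ℤ) * modulus n h v vβ * n) :
    ∀ du : MDir, ∀ k ≤ (vLocPrmD n ℓ h v T (WA n aW) (L0A bL) (NA n ℓ h T bL)).N,
      let PA := vLocPrmD n ℓ h v T (WA n aW) (L0A bL) (NA n ℓ h T bL)
      let lo := dLo 1 1 0 (-(PA.toLoc.L k + PA.e + PA.La)) (PA.toLoc.L k + PA.e + PA.La) (-(PA.Wk k + PA.e + PA.Lb)) (PA.Wk k + PA.e + PA.Lb)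
      let hi := dHi 1 1 0 (-(PA.toLoc.L k + PA.e + PA.La)) (PA.toLoc.L k + PA.e + PA.La) (-(PA.Wk k + PA.e + PA.Lb)) (PA.Wk k + PA.e + PA.Lb)
      (sgOf du = 1 → -(5 * (P.r du.1 : ℤ)) ≤ rdLo A n h v vβ c₀' c₁' D lo hi du.1 ∧ rdHi A n h v vβ c₀' c₁' D lo hi du.1 ≤ 22 * (P.r du.1 : ℤ)) ∧
      (sgOf du = -1 → -(5 * (P.r du.1 : ℤ)) ≤ -rdHi A n h v vβ c₀' c₁' D lo hi du.1 ∧ -rdLo A n h v vβ c₀' c₁' D lo hi du.1 ≤ 22 * (P.r du.1 : ℤ)) ∧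
      (-(2 * (P.r (oth du.1) : ℤ)) ≤ rdLo A n h v vβ c₀' c₁' D lo hi (oth du.1) ∧
        rdHi A n h v vβ c₀' c₁' D lo hi (oth du.1) ≤ 2 * (P.r (oth du.1) : ℤ)) :=
  fun du _ hk => rooms0_of_sym (symAK hn hA hD hm hc₀ hkq hsc0 hsc1 hr40 hPA hS1 hS0 hk) du

/-! ## §3 Segment B: the u-rounds -/

/-- **Every region of the u-rounds reads inside `±(2r_i − 1)` on both axes** under the two small-box floors of segment B.
[cite: KozmaNitzan2024, §4 Lemma 12 (pp. 23–25)] -/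
theorem symBK (hPB : LocOK (xLocPrm n ℓ h T (Qw n ℓ h) (L0B n ℓ h v T aW bL) (NB n ℓ h v T aW bL)))
    (hS1 : (shearUnit n h : ℤ) * (((qy n ℓ h v T aW bL : ℕ) : ℤ) + (3 * (n * ℓ) / shearUnit n h + 1 : ℕ) + 1) ≤ 77 * (kq : ℤ) * modulus n h v vβ)
    (hS0 : modulus n h v vβ * (((L0B n ℓ h v T aW bL : ℕ) : ℤ) + T + n) +
      |v| * ((shearUnit n h : ℤ) * (((qy n ℓ h v T aW bL : ℕ) : ℤ) + (3 * (n * ℓ) / shearUnit n h + 1 : ℕ) + 1)) ≤ 76 * (kq : ℤ) * modulus n h v vβ * n)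
    {k : ℕ} (hk : k ≤ NB n ℓ h v T aW bL) (i : Fin 2) :
    let PB := xLocPrm n ℓ h T (Qw n ℓ h) (L0B n ℓ h v T aW bL) (NB n ℓ h v T aW bL)
    let lo := dLo 0 1 0 (-(PB.L k + PB.e + PB.La)) (PB.L k + PB.e + PB.La) (-(PB.Wk k + PB.e + PB.Lb)) (PB.Wk k + PB.e + PB.Lb)
    let hi := dHi 0 1 0 (-(PB.L k + PB.e + PB.La)) (PB.L k + PB.e + PB.La) (-(PB.Wk k + PB.e + PB.Lb)) (PB.Wk k + PB.e + PB.Lb)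
    (-(2 * (P.r i : ℤ)) + 1 ≤ rdLo A n h v vβ c₀' c₁' D lo hi i) ∧ rdHi A n h v vβ c₀' c₁' D lo hi i ≤ 2 * (P.r i : ℤ) - 1 := by
  intro PB lo hi
  dsimp only [lo, hi]
  obtain ⟨e0, e1, e0', e1'⟩ := dLoHi_one_zero 0 (-(PB.L k + PB.e + PB.La)) (PB.L k + PB.e + PB.La) (-(PB.Wk k + PB.e + PB.Lb)) (PB.Wk k + PB.e + PB.Lb)
  have ho : oth (0 : Fin 2) = 1 := by decide
  rw [ho] at e1 e1'
  have hL0 : (PB.L0 : ℤ) = (L0B n ℓ h v T aW bL : ℕ) := rfl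
  have hsHi : PB.sHi = n := rfl
  have he : (PB.e : ℤ) = T := rfl
  have hLa : (PB.La : ℤ) = n := rfl
  have hLb : (PB.Lb : ℤ) = ((3 * (n * ℓ) / shearUnit n h + 1 : ℕ) : ℤ) := rfl
  have hWk : PB.Wk k = (Qw n ℓ h : ℕ) + (k : ℤ) * T := rfl
  have hLk : PB.L k ≤ ((L0B n ℓ h v T aW bL : ℕ) : ℤ) := by
    have h1 := LocPrm.L_le_max hPB k
    rw [hL0, hsHi] at h1
    have hnL : n ≤ L0B n ℓ h v T aW bL := (n_le_WA n aW).trans (Nat.le_add_right _ _)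
    have hnL' : (n : ℤ) ≤ ((L0B n ℓ h v T aW bL : ℕ) : ℤ) := by exact_mod_cast hnL
    exact h1.trans (max_le le_rfl hnL')
  have hLk0 : 0 ≤ PB.L k := LocPrm.L_nonneg hPB k
  have hWkb : PB.Wk k + T ≤ ((qy n ℓ h v T aW bL : ℕ) : ℤ) := by
    rw [hWk]; unfold qy; push_cast
    have hk' : (k : ℤ) ≤ (NB n ℓ h v T aW bL : ℕ) := by exact_mod_cast hk
    have hT0 : (0 : ℤ) ≤ (T : ℤ) := by positivity
    nlinarith
  have hWk0 : 0 ≤ PB.Wk k := LocPrm.Wk_nonneg PB k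
  set X₁ : ℤ := ((qy n ℓ h v T aW bL : ℕ) : ℤ) + (3 * (n * ℓ) / shearUnit n h + 1 : ℕ) with hX₁
  set X₀ : ℤ := ((L0B n ℓ h v T aW bL : ℕ) : ℤ) + T + n with hX₀
  have hT0 : (0 : ℤ) ≤ (T : ℤ) := by positivity
  refine rooms_smallK hn hA hD hm hc₀ hkq hsc0 hsc1 hr40 (X₀ := X₀) (X₁ := X₁) ?_ ?_ ?_ ?_ hS0 hS1 i
  · rw [e0, he, hLa]; linarith
  · rw [e0', he, hLa]; linarith
  · rw [e1, he, hLb, abs_le]; constructor <;> linarith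
  · rw [e1', he, hLb, abs_le]; constructor <;> linarith

/-- **The rooms of segment B with one unit of margin** (`hrd₂'`). [cite: KozmaNitzan2024, §4 Lemma 12] -/
theorem hrdB1K (hPB : LocOK (xLocPrm n ℓ h T (Qw n ℓ h) (L0B n ℓ h v T aW bL) (NB n ℓ h v T aW bL)))
    (hS1 : (shearUnit n h : ℤ) * (((qy n ℓ h v T aW bL : ℕ) : ℤ) + (3 * (n * ℓ) / shearUnit n h + 1 : ℕ) + 1) ≤ 77 * (kq : ℤ) * modulus n h v vβ)
    (hS0 : modulus n h v vβ * (((L0B n ℓ h v T aW bL : ℕ) : ℤ) + T + n) +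
      |v| * ((shearUnit n h : ℤ) * (((qy n ℓ h v T aW bL : ℕ) : ℤ) + (3 * (n * ℓ) / shearUnit n h + 1 : ℕ) + 1)) ≤ 76 * (kq : ℤ) * modulus n h v vβ * n) :
    ∀ du : MDir, ∀ k ≤ NB n ℓ h v T aW bL,
      let PB := xLocPrm n ℓ h T (Qw n ℓ h) (L0B n ℓ h v T aW bL) (NB n ℓ h v T aW bL)
      let lo := dLo 0 1 0 (-(PB.L k + PB.e + PB.La)) (PB.L k + PB.e + PB.La) (-(PB.Wk k + PB.e + PB.Lb)) (PB.Wk k + PB.e + PB.Lb)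
      let hi := dHi 0 1 0 (-(PB.L k + PB.e + PB.La)) (PB.L k + PB.e + PB.La) (-(PB.Wk k + PB.e + PB.Lb)) (PB.Wk k + PB.e + PB.Lb)
      (sgOf du = 1 → -(5 * (P.r du.1 : ℤ)) + 1 ≤ rdLo A n h v vβ c₀' c₁' D lo hi du.1 ∧ rdHi A n h v vβ c₀' c₁' D lo hi du.1 ≤ 22 * (P.r du.1 : ℤ) - 1) ∧
      (sgOf du = -1 → -(5 * (P.r du.1 : ℤ)) + 1 ≤ -rdHi A n h v vβ c₀' c₁' D lo hi du.1 ∧ -rdLo A n h v vβ c₀' c₁' D lo hi du.1 ≤ 22 * (P.r du.1 : ℤ) - 1) ∧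
      (-(2 * (P.r (oth du.1) : ℤ)) + 1 ≤ rdLo A n h v vβ c₀' c₁' D lo hi (oth du.1) ∧
        rdHi A n h v vβ c₀' c₁' D lo hi (oth du.1) ≤ 2 * (P.r (oth du.1) : ℤ) - 1) :=
  fun du _ hk => rooms1_of_sym (symBK hn hA hD hm hc₀ hkq hsc0 hsc1 hr40 hPB hS1 hS0 hk) du

/-- **The rooms of segment B** (`hrd₂`). [cite: KozmaNitzan2024, §4 Lemma 12] -/
theorem hrdB0K (hPB : LocOK (xLocPrm n ℓ h T (Qw n ℓ h) (L0B n ℓ h v T aW bL) (NB n ℓ h v T aW bL)))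
    (hS1 : (shearUnit n h : ℤ) * (((qy n ℓ h v T aW bL : ℕ) : ℤ) + (3 * (n * ℓ) / shearUnit n h + 1 : ℕ) + 1) ≤ 77 * (kq : ℤ) * modulus n h v vβ)
    (hS0 : modulus n h v vβ * (((L0B n ℓ h v T aW bL : ℕ) : ℤ) + T + n) +
      |v| * ((shearUnit n h : ℤ) * (((qy n ℓ h v T aW bL : ℕ) : ℤ) + (3 * (n * ℓ) / shearUnit n h + 1 : ℕ) + 1)) ≤ 76 * (kq : ℤ) * modulus n h v vβ * n) :
    ∀ du : MDir, ∀ k ≤ (xLocPrm n ℓ h T (Qw n ℓ h) (L0B n ℓ h v T aW bL) (NB n ℓ h v T aW bL)).N,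
      let PB := xLocPrm n ℓ h T (Qw n ℓ h) (L0B n ℓ h v T aW bL) (NB n ℓ h v T aW bL)
      let lo := dLo 0 1 0 (-(PB.L k + PB.e + PB.La)) (PB.L k + PB.e + PB.La) (-(PB.Wk k + PB.e + PB.Lb)) (PB.Wk k + PB.e + PB.Lb)
      let hi := dHi 0 1 0 (-(PB.L k + PB.e + PB.La)) (PB.L k + PB.e + PB.La) (-(PB.Wk k + PB.e + PB.Lb)) (PB.Wk k + PB.e + PB.Lb)
      (sgOf du = 1 → -(5 * (P.r du.1 : ℤ)) ≤ rdLo A n h v vβ c₀' c₁' D lo hi du.1 ∧ rdHi A n h v vβ c₀' c₁' D lo hi du.1 ≤ 22 * (P.r du.1 : ℤ)) ∧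
      (sgOf du = -1 → -(5 * (P.r du.1 : ℤ)) ≤ -rdHi A n h v vβ c₀' c₁' D lo hi du.1 ∧ -rdLo A n h v vβ c₀' c₁' D lo hi du.1 ≤ 22 * (P.r du.1 : ℤ)) ∧
      (-(2 * (P.r (oth du.1) : ℤ)) ≤ rdLo A n h v vβ c₀' c₁' D lo hi (oth du.1) ∧
        rdHi A n h v vβ c₀' c₁' D lo hi (oth du.1) ≤ 2 * (P.r (oth du.1) : ℤ)) :=
  fun du _ hk => rooms0_of_sym (symBK hn hA hD hm hc₀ hkq hsc0 hsc1 hr40 hPB hS1 hS0 hk) du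

end Rounds

end CorrRec

end Skelφ

end Transplant

end Summit.CriticalPhenomena.PercolationContinuityZ3.Theorems

end
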